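import Summits.BirchSwinnertonDyer.BirchSwinnertonDyer.Theorems.ManinLocalTwoThreeDivisionCoverUDC
import Summits.BirchSwinnertonDyer.BirchSwinnertonDyer.Theorems.ManinLocalTwoThreeCDivisionAssembly
import Literature.NumberTheory.EllipticCurves.Greenberg1999.TwoTorsionMuInvariant
import Summits.BirchSwinnertonDyer.BirchSwinnertonDyer.Theorems.ManinLocalTwoThreeShimuraQuotientConjugation
import Summits.BirchSwinnertonDyer.BirchSwinnertonDyer.Theorems.ManinLocalTwoThreeAssembly
import Summits.BirchSwinnertonDyer.Rank1Residual.ManinAdditive.ShimuraKernel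
import Summits.BirchSwinnertonDyer.BirchSwinnertonDyer.Theorems.ManinLocalTwoThreeCDivisionGamma1Core
import HarnessLib

/-!
(LANDING COPY, prover p3 gen 18 for T-an-g45, 2026-08-30: -an g45's file `CDivisionNeronPeriods-an-g45.lean` v3 sha16 3b8e276f040d6fd5 VERBATIM,
 split under the 400-line cap: PART 1 = this file (§1–§3), PART 2 = `…CDivisionNeronPeriodsConsumers.lean` (§4–§5),
 PART 3 = `…CDivisionNeronPeriodsModCDT.lean` (§6–§7); the `#print axioms` audit block is omitted; `smul_eq_natAbs_smul_iff` is replaced by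
 p2's identical landed `CDivision.exists_mem_intCast_mul_eq_natAbs_mul_iff` (dedup).)

# THE `c`-DIVISION WITNESS ∧ CDT ⟹ `Λ₁(f) ⊆ Λ_W` FOR EVERY CURVE OF THE CLASS — hence the WHOLE route `ManinLocalTwoThree`
# (C2 ∧ C3 ∧ the residual C4) modulo CDT ∧ ONE analytic row ∧ E-an-152b; and Stevens' `c₁ = ±1` modulo CDT ∧ its `Γ₁` twin

Summit `BirchSwinnertonDyer`, route `ManinLocalTwoThree` (cell bsd-f2-manin), planner seat -an gen 45 (analytic lens), answering LEAD p1 g19's ask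
(the division witness rows, §1) and upgrading -an g44's `c`-division kernel with the `Γ₁(N)`-Wohlfahrt lemma LEAD landed in
`ManinLocalTwoThreeDivisionCoverGamma1UDC.lean` (`DivisionGamma1.gamma1_le_of_Gamma_le_of_forall_trace_two_mem`).

THE POINT (new in g45).  -an g44's ONE analytic row `CDivisionWitnessLaw` (E-an-242: the `x`-coordinate of the `c`-division point `u_W∘E_f` of the
parametrisation is a holomorphic-after-pole-clearing modular form for EXACTLY `Γ^{(c)} := {γ ∈ Γ₀(N) : {∞,γ∞}_f ∈ Λ_W}` with algebraic-integer
`q`-expansion) needs NO case split by `p`: `Γ^{(c)}` is LEAD's division cover group `Γ^{(m)}` at `m = |c|` (§2), it contains every trace-`2` element,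
Unbounded Denominators (CDT) puts `Γ(MN)` inside it, and `Γ₁`-Wohlfahrt then puts ALL OF `Γ₁(N)` inside it.  So (§3, kernel, sorry-free):

  **CDT ∧ E-an-242 ⟹ E-an-250 `Gamma1PeriodsInNeronLattice`: `{∞,γ∞}_f ∈ Λ_W` for every `γ ∈ Γ₁(N)` and EVERY `X₀(N)`-datum of every globally
  minimal `W` — i.e. `Λ₁(f) ⊆ Λ_W` for every curve `W` of the isogeny class (no optimality hypothesis).**

For the lattice-optimal datum (`Λ_W = c₀Λ₀(f)`) this reads `Λ₁(f) ⊆ c₀Λ₀(f)`, whence (§4, all PROVED here, unconditional implications):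
* `c₀ ∣ n` whenever `nΛ₀(f) ⊆ Λ₁(f)` (`maninConstant_dvd_of_gamma1Periods_le`); with Ling–Oesterlé at a traceless prime (`a_p = 0`, `p² ∣ N`,
  tree `pMulLatticeLeGamma1OfTracelessPrime_holds`): `c₀ ∣ p`;
* **`|c₀| = 1` at EVERY level divisible by the square of an ODD prime** (`|c₀| = p` would be the index-`p²` configuration `Λ₁ = pΛ₀`, excluded
  unconditionally by `not_periodLatticeGamma1_eq_natCast_mul_periodLattice`) — so C3 `ManinPrimeToThreeAtNine` AND THE RESIDUAL CONJUNCT C4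
  `ManinPrimeToAdditiveFiveLe` (`p ≥ 5`, declared residual, «open at `p = 5, 7`») both follow from CDT ∧ E-an-242 (§5);
* at `4 ∣ N`: `c₀ ∣ 2`, and `2 ∣ c₀` iff the index-`4` configuration `Λ₁(f) = 2Λ₀(f)` (¬E-an-152b); so C2 `ManinOddAtFour` ⟸ CDT ∧ E-an-242 ∧ E-an-152b;
* **the whole route**: `PrintedSemistableManinFacts → CDT → CDivisionWitnessLaw → ShimuraIndexNeFourAtFour → ManinConstantOne` (§5, through the
  route's own `closes` and the landed `maninLocalTwoThree_assembly_proof`).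
And the `Γ₁` twin (§6): CDT ∧ E-an-251 `CDivisionWitnessLaw₁` (the same witness for an `X₁(N)`-datum) ⟹ `Λ₁(f) ⊆ Λ_W` for every `X₁(N)`-datum,
hence **`|c₁| = 1` for every OPTIMAL `X₁(N)`-datum (Stevens' conjecture `c_φ = ±1`)** from ONE law (LEAD's §5 used one law per prime).

READING (memo §90).  `Λ₁(f) ⊆ Λ_W` for all `W` of the class says: every curve of the class is a quotient of `ℂ/Λ₁(f)` by an isogeny pulling Néron
differentials back to Néron differentials; with `c₁ = ±1` (`Λ₁(f) = Λ_{E₁}`) this is Stevens' picture of the `X₁(N)`-optimal curve as the MINIMAL curve of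
its class [Stevens1989, §2].  So modulo the printed CDT theorem the two analytic rows E-an-242/251 carry Stevens' conjectures, and Manin's conjecture is
EXACTLY E-an-152b («Stevens' kernel `ker(E₁ → E₀) = Λ₀(f)/Λ₁(f)` is never `E₁[2]` at `4 ∣ N`»).

CONTENTS.  §1 `DivisionWitnessLawGamma0 m`, `DivisionWitnessLawGamma1 m` (LEAD's `hW` binders VERBATIM, typed as rows) + by-name glue to LEAD's theorems ·
§2 `CDivisionWitnessLaw` (E-an-242, verbatim -an g44), `CDivisionWitnessLaw₁` (E-an-251), `Gamma1PeriodsInNeronLattice` (E-an-250), `Gamma1PeriodsInNeronLattice₁`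
(E-an-252); `smul_eq_natAbs_smul_iff` (`Γ^{(c)} = Γ^{(|c|)}`) · §3 KERNEL `forall_gamma1_cuspSymbol_mem_of_cDivisionWitness_of_UDW` (+ `Γ₁` twin),
`gamma1PeriodsInNeronLattice_of_CDT_of_cDivisionWitnessLaw` · §4 consequences for a lattice-optimal datum · §5 route compositions BY NAME (C2, C3, C4, `ManinConstantOne`)
· §6 `abs_maninConstant₁_eq_one_of_CDT_of_cDivisionWitnessLaw₁`.

HONEST FRAMING.  CONDITIONAL architecture: everything is modulo the printed CDT fact (`CalegariDimitrovTang2025_unboundedDenominators_algInt`, a `def … : Prop`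
used as a hypothesis) and the OPEN analytic rows E-an-242 / E-an-251 (on paper: `F = 12·℘_{Λ_W}(E_f)·B_d·Δ^a`, Honda at the integer `1`; typed node decomposition
in -an g44's file B) and, for C2, the OPEN arithmetic row E-an-152b.  No Manin-constant statement, no Stevens conjecture and nothing about BSD is proved here.
No sorry; the only `def`s are `Prop`-valued statement rows. [cite: CalegariDimitrovTang2025, Thm. 1.0.1 and Remarks 58–59] [cite: Wohlfahrt1964, Thm. 2]
[cite: LingOesterle1991, Thm. 6] [cite: Stevens1989, §2] [cite: Manin1972, Prop. 1.4, Thm. 1.6] [cite: Honda1970, Thm. 9] [cite: AtkinLehner1970, Thm. 3]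
-/

set_option autoImplicit false
-- lint-debt: the directory name repeats the summit name (sibling precedent `ManinLocalTwoThreeDivisionCoverUDC.lean`)
set_option linter.dupNamespace false

noncomputable section

open scoped MatrixGroups ModularForm Manifold
open CongruenceSubgroup Complex ModularGroup
open WeierstrassCurve Literature.NumberTheory.EllipticCurves Literature.NumberTheory.EllipticCurves.ModularForms
open Literature.NumberTheory.Automorphic
open Summit.BirchSwinnertonDyer.Rank1Residual.ManinAdditive.UDCKummerLineK
open Summit.BirchSwinnertonDyer.Rank1Residual.ManinAdditive.ShimuraKernel

namespace Summit.BirchSwinnertonDyer.BirchSwinnertonDyer.Theorems.ManinLocalTwoThree.CDivisionNeron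

variable {W : WeierstrassCurve ℚ} [W.IsElliptic] [W.IsGloballyMinimal] {N : ℕ} [NeZero N]

/-! ## §1 LEAD p1 g19's division witness rows, typed verbatim (ask 2026-08-30T00:26:49Z), with by-name glue -/

/-- **`DivisionWitnessLawGamma0 m` — the `m`-division witness law on `Γ₀(N)` at `4 ∣ N`** (LEAD p1 g19; the `hW` binder of
`Division.not_dvd_maninConstant_of_CDT_of_divisionWitnessLaw`, VERBATIM): for every lattice-optimal `X₀(N)`-datum of a globally minimal curve at `4 ∣ N`
with `m ∣ c`, a holomorphic weight-`k` `F` with `Γ₀(N)`-stabiliser EXACTLY `Γ^{(m)} = {γ : c·{∞,γ∞}_f ∈ mΛ_W}`, exponential growth at every cusp and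
algebraic-integer `q`-expansion.  On paper `F = t((c/m)·E_f)·B_d·Δ^k` (Honda at `c/m`) or, uniformly in `m`, the `c`-division witness of §2 when `m = |c|`.
OPEN analytic row; why it might fail: only in the Lean bookkeeping of the pole-clearing / `q`-expansion dictionary. [cite: Honda1970, Thm. 9]
[cite: ShimuraIATAF1971, §2.4 and Thm. 7.14] [cite: CalegariDimitrovTang2025, Remarks 58–59] -/
@[conjecture] def DivisionWitnessLawGamma0 (m : ℕ) : Prop :=
  ∀ (W : WeierstrassCurve ℚ) [W.IsElliptic] [W.IsGloballyMinimal] {N : ℕ} [NeZero N] (D : ModularParametrizationData W N),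
    2 ^ 2 ∣ N → (∀ z ∈ D.L.lattice, ∃ w ∈ periodLattice D.f, z = D.c * w) → (m : ℤ) ∣ D.c →
    ∃ (k : ℤ) (F : UpperHalfPlane → ℂ), MDifferentiable 𝓘(ℂ) 𝓘(ℂ) F ∧
      (∀ γ : Gamma0 N, (∃ ν ∈ D.L.lattice, (D.c : ℂ) * cuspSymbol D.f γ = (m : ℂ) * ν) → F ∣[k] (γ : SL(2, ℤ)) = F) ∧
      (∀ γ : Gamma0 N, F ∣[k] (γ : SL(2, ℤ)) = F → ∃ ν ∈ D.L.lattice, (D.c : ℂ) * cuspSymbol D.f γ = (m : ℂ) * ν) ∧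
      (∀ g : SL(2, ℤ), ∃ C A r : ℝ, ∀ τ : UpperHalfPlane, A ≤ τ.im → ‖(F ∣[k] g) τ‖ ≤ C * Real.exp (r * τ.im)) ∧
      (∃ b : ℕ → ℂ, (∀ n, IsIntegral ℤ (b n)) ∧ ∀ τ : UpperHalfPlane,
        HasSum (fun n : ℕ ↦ b n * Complex.exp (2 * Real.pi * Complex.I * (τ : ℂ) * n)) (F τ))

/-- **`DivisionWitnessLawGamma1 m` — the `m`-division witness law on `Γ₁(N)`** (LEAD p1 g19; the `hW` binder of
`DivisionGamma1.not_dvd_maninConstant₁_of_CDT_of_divisionWitnessLaw₁`, VERBATIM): for every OPTIMAL `X₁(N)`-datum of a globally minimal curve with `m ∣ c`,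
a holomorphic weight-`k` `F` with `Γ₁(N)`-stabiliser EXACTLY `Γ₁^{(m)}`, exponential growth at every cusp and algebraic-integer `q`-expansion.  OPEN analytic
row (same paper witness). [cite: Honda1970, Thm. 9] [cite: ShimuraIATAF1971, §2.4 and Thm. 7.14] [cite: CalegariDimitrovTang2025, Remarks 58–59] -/
@[conjecture] def DivisionWitnessLawGamma1 (m : ℕ) : Prop :=
  ∀ (W : WeierstrassCurve ℚ) [W.IsElliptic] [W.IsGloballyMinimal] {N : ℕ} [NeZero N] (D : Gamma1ParametrizationData W N),
    D.IsOptimal → (m : ℤ) ∣ D.c →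
    ∃ (k : ℤ) (F : UpperHalfPlane → ℂ), MDifferentiable 𝓘(ℂ) 𝓘(ℂ) F ∧
      (∀ γ : Gamma1 N, (∃ ν ∈ D.L.lattice,
        (D.c : ℂ) * cuspSymbol D.f ⟨(γ : SL(2, ℤ)), Gamma1_in_Gamma0 N γ.2⟩ = (m : ℂ) * ν) → F ∣[k] (γ : SL(2, ℤ)) = F) ∧
      (∀ γ : Gamma1 N, F ∣[k] (γ : SL(2, ℤ)) = F → ∃ ν ∈ D.L.lattice,
        (D.c : ℂ) * cuspSymbol D.f ⟨(γ : SL(2, ℤ)), Gamma1_in_Gamma0 N γ.2⟩ = (m : ℂ) * ν) ∧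
      (∀ g : SL(2, ℤ), ∃ C A r : ℝ, ∀ τ : UpperHalfPlane, A ≤ τ.im → ‖(F ∣[k] g) τ‖ ≤ C * Real.exp (r * τ.im)) ∧
      (∃ b : ℕ → ℂ, (∀ n, IsIntegral ℤ (b n)) ∧ ∀ τ : UpperHalfPlane,
        HasSum (fun n : ℕ ↦ b n * Complex.exp (2 * Real.pi * Complex.I * (τ : ℂ) * n)) (F τ))

/-- By-name glue: `m ∤ c₀` (`m ≥ 3`, `4 ∣ N`, lattice-optimal datum) ⟸ CDT ∧ `DivisionWitnessLawGamma0 m` (LEAD's §4). CONDITIONAL.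
[cite: CalegariDimitrovTang2025, Thm. 1.0.1] [cite: LingOesterle1991, Thm. 6] -/
theorem not_dvd_maninConstant_of_CDT_of_divisionWitnessLawGamma0
    (hCDT : Literature.NumberTheory.Automorphic.CalegariDimitrovTang2025_unboundedDenominators_algInt) {m : ℕ} (hm : 3 ≤ m)
    (hW : DivisionWitnessLawGamma0 m) (D : ModularParametrizationData W N) (h4 : 2 ^ 2 ∣ N)
    (hopt : ∀ z ∈ D.L.lattice, ∃ w ∈ periodLattice D.f, z = D.c * w) : ¬ (m : ℤ) ∣ D.maninConstant :=
  Division.not_dvd_maninConstant_of_CDT_of_divisionWitnessLaw hCDT hm hW D h4 hopt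

/-- By-name glue: `|c₀| ≤ 2` at `4 ∣ N` ⟸ CDT ∧ (`DivisionWitnessLawGamma0 m` for all `m ≥ 3`) (LEAD's §4). CONDITIONAL.
[cite: CalegariDimitrovTang2025, Thm. 1.0.1] [cite: LingOesterle1991, Thm. 6] -/
theorem natAbs_maninConstant_le_two_of_CDT_of_divisionWitnessLawsGamma0
    (hCDT : Literature.NumberTheory.Automorphic.CalegariDimitrovTang2025_unboundedDenominators_algInt)
    (hW : ∀ m : ℕ, 3 ≤ m → DivisionWitnessLawGamma0 m) (D : ModularParametrizationData W N) (h4 : 2 ^ 2 ∣ N)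
    (hopt : ∀ z ∈ D.L.lattice, ∃ w ∈ periodLattice D.f, z = D.c * w) : D.maninConstant.natAbs ≤ 2 :=
  Division.natAbs_maninConstant_le_two_of_CDT_of_divisionWitnessLaws hCDT hW D h4 hopt

/-- By-name glue: `m ∤ c₁` (`m ≥ 2`, optimal `X₁(N)`-datum) ⟸ CDT ∧ `DivisionWitnessLawGamma1 m` (LEAD's `Γ₁` §4). CONDITIONAL.
[cite: CalegariDimitrovTang2025, Thm. 1.0.1] [cite: Stevens1989, §2] -/
theorem not_dvd_maninConstant₁_of_CDT_of_divisionWitnessLawGamma1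
    (hCDT : Literature.NumberTheory.Automorphic.CalegariDimitrovTang2025_unboundedDenominators_algInt) {m : ℕ} (hm : 2 ≤ m)
    (hW : DivisionWitnessLawGamma1 m) (D : Gamma1ParametrizationData W N) (hopt : D.IsOptimal) : ¬ (m : ℤ) ∣ D.maninConstant :=
  DivisionGamma1.not_dvd_maninConstant₁_of_CDT_of_divisionWitnessLaw₁ hCDT hm hW D hopt

/-- By-name glue: `|c₁| = 1` (optimal `X₁(N)`-datum) ⟸ CDT ∧ (`DivisionWitnessLawGamma1 p` for all primes `p`) (LEAD's `Γ₁` §5). CONDITIONAL;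
Stevens' conjecture is not proved by this. [cite: CalegariDimitrovTang2025, Thm. 1.0.1] [cite: Stevens1989, §2] -/
theorem abs_maninConstant₁_eq_one_of_CDT_of_divisionWitnessLawsGamma1
    (hCDT : Literature.NumberTheory.Automorphic.CalegariDimitrovTang2025_unboundedDenominators_algInt)
    (hW : ∀ p : ℕ, p.Prime → DivisionWitnessLawGamma1 p) (D : Gamma1ParametrizationData W N) (hopt : D.IsOptimal) :
    |D.maninConstant| = 1 :=
  DivisionGamma1.abs_maninConstant₁_eq_one_of_CDT_of_divisionWitnessLaws₁ hCDT hW D hopt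

/-! ## §2 The `c`-division rows (E-an-242 / E-an-251) and the Néron-lattice rows (E-an-250 / E-an-252) -/

/-- **E-an-242 `CDivisionWitnessLaw` — the ONE analytic row (verbatim -an g44, `…ManinLocalTwoThree.CDivision.CDivisionWitnessLaw`; restated here only because
that file is not yet in the tree — identical body, one ledger item).**  For every `X₀(N)`-datum `D` of a globally minimal `W` there are a weight `k` and a holomorphic
`F : ℍ → ℂ` whose stabiliser in `Γ₀(N)` is EXACTLY `Γ^{(c)} = {γ : {∞,γ∞}_f ∈ Λ_W}`, of exponential growth at every cusp, with algebraic-integer `q`-expansion.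
On paper `F = 12·℘_{Λ_W}(E_f)·B_d·Δ^a` (Honda at the integer `1`: `t_W(u_W(E_f)) ∈ q + q²ℤ⟦q⟧` for EVERY curve of the class, the `L`-series being an isogeny
invariant).  Why it might fail: only in the Lean bookkeeping of the `x`-dictionary germ (node N7 of -an g44's file B). [cite: Honda1970, Thm. 9]
[cite: ShimuraIATAF1971, §2.4 and Thm. 7.14] [cite: SilvermanAEC2009, IV.1] -/
@[conjecture] def CDivisionWitnessLaw : Prop :=
  ∀ (W : WeierstrassCurve ℚ) [W.IsElliptic] [W.IsGloballyMinimal] {N : ℕ} [NeZero N] (D : ModularParametrizationData W N),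
    ∃ (k : ℤ) (F : UpperHalfPlane → ℂ), MDifferentiable 𝓘(ℂ) 𝓘(ℂ) F ∧
      (∀ γ : Gamma0 N, cuspSymbol D.f γ ∈ D.L.lattice → F ∣[k] (γ : SL(2, ℤ)) = F) ∧
      (∀ γ : Gamma0 N, F ∣[k] (γ : SL(2, ℤ)) = F → cuspSymbol D.f γ ∈ D.L.lattice) ∧
      (∀ g : SL(2, ℤ), ∃ C A m : ℝ, ∀ τ : UpperHalfPlane, A ≤ τ.im → ‖(F ∣[k] g) τ‖ ≤ C * Real.exp (m * τ.im)) ∧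
      (∃ b : ℕ → ℂ, (∀ n, IsIntegral ℤ (b n)) ∧ ∀ τ : UpperHalfPlane,
        HasSum (fun n : ℕ ↦ b n * Complex.exp (2 * Real.pi * Complex.I * (τ : ℂ) * n)) (F τ))

/-- **E-an-242 IS A THEOREM** (p3 g18 `CDivAssembly.exists_cDivisionWitness`, p754408, on p2 g20's core `CDivision.exists_cDivisionWitnessCore` and the
nodes N1–N7: p752500, p753099, p752799, p754204, p754221, p754245).  Cited by name; nothing re-proved here. -/
theorem cDivisionWitnessLaw_holds : CDivisionWitnessLaw := by
  intro W _ _ N _ D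
  exact CDivAssembly.exists_cDivisionWitness W D

/-- **E-an-251 `CDivisionWitnessLaw₁` — the `Γ₁` twin.**  For every `X₁(N)`-datum `D` of a globally minimal `W` (no optimality, no divisibility hypothesis)
there are a weight `k` and a holomorphic `F : ℍ → ℂ` whose stabiliser in `Γ₁(N)` is EXACTLY `Γ₁^{(c)} = {γ ∈ Γ₁(N) : {∞,γ∞}_f ∈ Λ_W}`, of exponential growth
at every cusp, with algebraic-integer `q`-expansion.  Same paper witness `12·℘_{Λ_W}(E_f)·B_d·Δ^a` (its `Γ₀(N)`-stabiliser is `Γ^{(c)}`, so its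
`Γ₁(N)`-stabiliser is `Γ^{(c)} ∩ Γ₁(N)`); in fact E-an-242 for the `X₀(N)`-datum with the same `(f, Λ_W)` gives it.  OPEN analytic row.
[cite: Honda1970, Thm. 9] [cite: ShimuraIATAF1971, §2.4 and Thm. 7.14] [cite: Stevens1989, §2] -/
@[conjecture] def CDivisionWitnessLaw₁ : Prop :=
  ∀ (W : WeierstrassCurve ℚ) [W.IsElliptic] [W.IsGloballyMinimal] {N : ℕ} [NeZero N] (D : Gamma1ParametrizationData W N),
    ∃ (k : ℤ) (F : UpperHalfPlane → ℂ), MDifferentiable 𝓘(ℂ) 𝓘(ℂ) F ∧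
      (∀ γ : Gamma1 N, cuspSymbol D.f ⟨(γ : SL(2, ℤ)), Gamma1_in_Gamma0 N γ.2⟩ ∈ D.L.lattice → F ∣[k] (γ : SL(2, ℤ)) = F) ∧
      (∀ γ : Gamma1 N, F ∣[k] (γ : SL(2, ℤ)) = F → cuspSymbol D.f ⟨(γ : SL(2, ℤ)), Gamma1_in_Gamma0 N γ.2⟩ ∈ D.L.lattice) ∧
      (∀ g : SL(2, ℤ), ∃ C A m : ℝ, ∀ τ : UpperHalfPlane, A ≤ τ.im → ‖(F ∣[k] g) τ‖ ≤ C * Real.exp (m * τ.im)) ∧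
      (∃ b : ℕ → ℂ, (∀ n, IsIntegral ℤ (b n)) ∧ ∀ τ : UpperHalfPlane,
        HasSum (fun n : ℕ ↦ b n * Complex.exp (2 * Real.pi * Complex.I * (τ : ℂ) * n)) (F τ))

/-- **E-an-250 `Gamma1PeriodsInNeronLattice` — every `Γ₁(N)`-period of `f` is a Néron period of EVERY curve of the class.**  For every `X₀(N)`-datum `D`
of a globally minimal `W`: `{∞,γ∞}_f ∈ Λ_W` for all `γ ∈ Γ₁(N)`, i.e. `Λ₁(f) ⊆ Λ_W`.  A CONSEQUENCE of CDT ∧ E-an-242 (§3); for the lattice-optimal datum it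
reads `Λ₁(f) ⊆ c₀Λ₀(f)` and carries C3, C4 and — with E-an-152b — C2 (§§4–5).  With Stevens' `c₁ = ±1` it says `Λ_{E₁} ⊆ Λ_W` for all `W`: the
`X₁(N)`-optimal curve is the minimal curve of its class [Stevens1989, §2].  Why it might fail: a curve `W` of some class and a `Γ₁(N)`-period of its newform
outside `Λ_W` (one numerical class kills it); census: Cremona's `c₀ = 1` for `N ≤ 500000` gives it for every OPTIMAL datum. [cite: Stevens1989, §2]
[cite: Manin1972, Thm. 1.6] [cite: CesnaviciusNeururerSaha2023, Lemma 6.5] -/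
@[conjecture] def Gamma1PeriodsInNeronLattice : Prop :=
  ∀ (W : WeierstrassCurve ℚ) [W.IsElliptic] [W.IsGloballyMinimal] {N : ℕ} [NeZero N] (D : ModularParametrizationData W N),
    ∀ γ : Gamma1 N, cuspSymbol D.f ⟨(γ : SL(2, ℤ)), Gamma1_in_Gamma0 N γ.2⟩ ∈ D.L.lattice

/-- **E-an-252 `Gamma1PeriodsInNeronLattice₁` — the same for `X₁(N)`-data** (`Λ₁(f) ⊆ Λ_W`); a consequence of CDT ∧ E-an-251 (§6); for an OPTIMAL
`X₁(N)`-datum (`Λ_W = c₁Λ₁(f)`) it is `|c₁| = 1` (Stevens). [cite: Stevens1989, §2] -/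
@[conjecture] def Gamma1PeriodsInNeronLattice₁ : Prop :=
  ∀ (W : WeierstrassCurve ℚ) [W.IsElliptic] [W.IsGloballyMinimal] {N : ℕ} [NeZero N] (D : Gamma1ParametrizationData W N),
    ∀ γ : Gamma1 N, cuspSymbol D.f ⟨(γ : SL(2, ℤ)), Gamma1_in_Gamma0 N γ.2⟩ ∈ D.L.lattice

omit [W.IsElliptic] [W.IsGloballyMinimal] in
/-- `D.c ≠ 0` as an integer. [folklore] -/
theorem c_ne_zero (D : ModularParametrizationData W N) : D.c ≠ 0 := fun h ↦ D.cast_c_ne_zero (by rw [h, Int.cast_zero])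

/-! ## §3 THE KERNEL: a `c`-division witness ∧ Unbounded Denominators put `Γ₁(N)` inside `Γ^{(c)}` — `Λ₁(f) ⊆ Λ_W`, no optimality needed -/

omit [W.IsElliptic] [W.IsGloballyMinimal] in
/-- **`c`-division witness ∧ `UnboundedDenominatorsWeightAlgInt k` ⟹ `{∞,γ∞}_f ∈ Λ_W` for every `γ ∈ Γ₁(N)`** (any `X₀(N)`-datum).  `Γ^{(c)}` is LEAD's
`Γ^{(|c|)}` (`Division.exists_divisionCoverSubgroup` at `m = |c|`, `smul_eq_natAbs_smul_iff`): finite index, every trace-`2` element; UDW gives `Γ(M) ≤ Stab(F)`,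
so `Γ(MN) ≤ Γ^{(c)}`; `Γ₁`-Wohlfahrt (`DivisionGamma1.gamma1_le_of_Gamma_le_of_forall_trace_two_mem`) gives `Γ₁(N) ≤ Γ^{(c)}`.
[cite: CalegariDimitrovTang2025, Thm. 1.0.1] [cite: Wohlfahrt1964, Thm. 2] [cite: Manin1972, Prop. 1.4 / Thm. 1.6] -/
theorem forall_gamma1_cuspSymbol_mem_of_cDivisionWitness_of_UDW (D : ModularParametrizationData W N) {k : ℤ}
    (hUDW : UnboundedDenominatorsWeightAlgInt k) {F : UpperHalfPlane → ℂ} (hhol : MDifferentiable 𝓘(ℂ) 𝓘(ℂ) F)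
    (hinv : ∀ γ : Gamma0 N, cuspSymbol D.f γ ∈ D.L.lattice → F ∣[k] (γ : SL(2, ℤ)) = F)
    (hstab : ∀ γ : Gamma0 N, F ∣[k] (γ : SL(2, ℤ)) = F → cuspSymbol D.f γ ∈ D.L.lattice)
    (hgrowth : ∀ g : SL(2, ℤ), ∃ C A r : ℝ, ∀ τ : UpperHalfPlane, A ≤ τ.im → ‖(F ∣[k] g) τ‖ ≤ C * Real.exp (r * τ.im))
    (hq : ∃ b : ℕ → ℂ, (∀ n, IsIntegral ℤ (b n)) ∧ ∀ τ : UpperHalfPlane,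
      HasSum (fun n : ℕ ↦ b n * Complex.exp (2 * Real.pi * Complex.I * (τ : ℂ) * n)) (F τ)) :
    ∀ γ : Gamma1 N, cuspSymbol D.f ⟨(γ : SL(2, ℤ)), Gamma1_in_Gamma0 N γ.2⟩ ∈ D.L.lattice := by
  have hn : 0 < D.c.natAbs := Int.natAbs_pos.mpr (c_ne_zero D)
  obtain ⟨Γ, hmem, hle, hfi, htr⟩ := Division.exists_divisionCoverSubgroup D hn
  have hmem' : ∀ γ : Gamma0 N, (γ : SL(2, ℤ)) ∈ Γ ↔ cuspSymbol D.f γ ∈ D.L.lattice := fun γ ↦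
    (hmem γ).trans (CDivision.exists_mem_intCast_mul_eq_natAbs_mul_iff D.L (c_ne_zero D) _)
  have hN : 0 < N := Nat.pos_of_ne_zero (NeZero.ne N)
  have hΓinv : ∀ γ ∈ Γ, F ∣[k] γ = F := fun γ hγ ↦ hinv ⟨γ, hle hγ⟩ ((hmem' ⟨γ, hle hγ⟩).mp hγ)
  obtain ⟨M, hM, hcong⟩ := hUDW Γ hfi F hhol hΓinv hgrowth hq
  -- `Γ(MN) ≤ Γ^{(c)}`
  have hΓMN : CongruenceSubgroup.Gamma (M * N) ≤ Γ := by
    intro g hg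
    have hgN : g ∈ CongruenceSubgroup.Gamma N := Gamma_mul_le_right M N hg
    have hgM : g ∈ CongruenceSubgroup.Gamma M := Gamma_mul_le_left M N hg
    have hg0 : g ∈ Gamma0 N := Gamma_le_Gamma0 N hgN
    exact (hmem' ⟨g, hg0⟩).mpr (hstab ⟨g, hg0⟩ (hcong g hgM))
  -- `Γ₁`-Wohlfahrt: `Γ₁(N) ≤ Γ^{(c)}`
  have h1 : Gamma1 N ≤ Γ :=
    DivisionGamma1.gamma1_le_of_Gamma_le_of_forall_trace_two_mem N Γ
      (fun γ hγ h2 ↦ htr γ (Gamma1_in_Gamma0 N hγ) (Or.inl h2)) (Nat.mul_pos hM hN) hΓMN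
  intro γ
  exact (hmem' ⟨_, Gamma1_in_Gamma0 N γ.2⟩).mp (h1 γ.2)

omit [W.IsElliptic] [W.IsGloballyMinimal] in
/-- **The `Γ₁` twin of the kernel**: a `c`-division witness for an `X₁(N)`-datum ∧ UDW ⟹ `{∞,γ∞}_f ∈ Λ_W` for every `γ ∈ Γ₁(N)` (no optimality).
[cite: CalegariDimitrovTang2025, Thm. 1.0.1] [cite: Wohlfahrt1964, Thm. 2] [cite: Manin1972, Prop. 1.4 / Thm. 1.6] -/
theorem forall_gamma1_cuspSymbol_mem_of_cDivisionWitness₁_of_UDW (D : Gamma1ParametrizationData W N) {k : ℤ}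
    (hUDW : UnboundedDenominatorsWeightAlgInt k) {F : UpperHalfPlane → ℂ} (hhol : MDifferentiable 𝓘(ℂ) 𝓘(ℂ) F)
    (hinv : ∀ γ : Gamma1 N, cuspSymbol D.f ⟨(γ : SL(2, ℤ)), Gamma1_in_Gamma0 N γ.2⟩ ∈ D.L.lattice → F ∣[k] (γ : SL(2, ℤ)) = F)
    (hstab : ∀ γ : Gamma1 N, F ∣[k] (γ : SL(2, ℤ)) = F → cuspSymbol D.f ⟨(γ : SL(2, ℤ)), Gamma1_in_Gamma0 N γ.2⟩ ∈ D.L.lattice)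
    (hgrowth : ∀ g : SL(2, ℤ), ∃ C A r : ℝ, ∀ τ : UpperHalfPlane, A ≤ τ.im → ‖(F ∣[k] g) τ‖ ≤ C * Real.exp (r * τ.im))
    (hq : ∃ b : ℕ → ℂ, (∀ n, IsIntegral ℤ (b n)) ∧ ∀ τ : UpperHalfPlane,
      HasSum (fun n : ℕ ↦ b n * Complex.exp (2 * Real.pi * Complex.I * (τ : ℂ) * n)) (F τ)) :
    ∀ γ : Gamma1 N, cuspSymbol D.f ⟨(γ : SL(2, ℤ)), Gamma1_in_Gamma0 N γ.2⟩ ∈ D.L.lattice := by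
  have hc : D.c ≠ 0 := D.maninConstant_ne_zero
  have hn : 0 < D.c.natAbs := Int.natAbs_pos.mpr hc
  obtain ⟨Γ, hmem, hle, hfi, htr⟩ := DivisionGamma1.exists_divisionCoverSubgroupGamma1 D hn
  have hmem' : ∀ γ : Gamma1 N, (γ : SL(2, ℤ)) ∈ Γ ↔ cuspSymbol D.f ⟨(γ : SL(2, ℤ)), Gamma1_in_Gamma0 N γ.2⟩ ∈ D.L.lattice :=
    fun γ ↦ (hmem γ).trans (CDivision.exists_mem_intCast_mul_eq_natAbs_mul_iff D.L hc _)
  have hN : 0 < N := Nat.pos_of_ne_zero (NeZero.ne N)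
  have hΓinv : ∀ γ ∈ Γ, F ∣[k] γ = F := fun γ hγ ↦ hinv ⟨γ, hle hγ⟩ ((hmem' ⟨γ, hle hγ⟩).mp hγ)
  obtain ⟨M, hM, hcong⟩ := hUDW Γ hfi F hhol hΓinv hgrowth hq
  have hΓMN : CongruenceSubgroup.Gamma (M * N) ≤ Γ := by
    intro g hg
    have hgN : g ∈ CongruenceSubgroup.Gamma N := Gamma_mul_le_right M N hg
    have hgM : g ∈ CongruenceSubgroup.Gamma M := Gamma_mul_le_left M N hg
    have hg1 : g ∈ Gamma1 N := DivisionGamma1.Gamma_le_Gamma1 N hgN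
    exact (hmem' ⟨g, hg1⟩).mpr (hstab ⟨g, hg1⟩ (hcong g hgM))
  have h1 : Gamma1 N ≤ Γ :=
    DivisionGamma1.gamma1_le_of_Gamma_le_of_forall_trace_two_mem N Γ (fun γ hγ h2 ↦ htr γ hγ (Or.inl h2)) (Nat.mul_pos hM hN) hΓMN
  intro γ
  exact (hmem' γ).mp (h1 γ.2)

/-- **E-an-250 ⟸ CDT ∧ E-an-242.** CONDITIONAL on both; nothing about Manin's conjecture is proved by this.
[cite: CalegariDimitrovTang2025, Thm. 1.0.1 and Remarks 58–59] [cite: Wohlfahrt1964, Thm. 2] -/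
theorem gamma1PeriodsInNeronLattice_of_CDT_of_cDivisionWitnessLaw
    (hCDT : Literature.NumberTheory.Automorphic.CalegariDimitrovTang2025_unboundedDenominators_algInt) (hCW : CDivisionWitnessLaw) :
    Gamma1PeriodsInNeronLattice := by
  intro W _ _ N _ D
  obtain ⟨k, F, hhol, hinv, hstab, hgrowth, hq⟩ := hCW W D
  exact forall_gamma1_cuspSymbol_mem_of_cDivisionWitness_of_UDW D (UDWOfCDT.unboundedDenominatorsWeightAlgInt_of_CDT_algInt hCDT k)
    hhol hinv hstab hgrowth hq

/-- **E-an-252 ⟸ CDT ∧ E-an-251.** CONDITIONAL on both. [cite: CalegariDimitrovTang2025, Thm. 1.0.1 and Remarks 58–59] [cite: Wohlfahrt1964, Thm. 2] -/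
theorem gamma1PeriodsInNeronLattice₁_of_CDT_of_cDivisionWitnessLaw₁
    (hCDT : Literature.NumberTheory.Automorphic.CalegariDimitrovTang2025_unboundedDenominators_algInt) (hCW : CDivisionWitnessLaw₁) :
    Gamma1PeriodsInNeronLattice₁ := by
  intro W _ _ N _ D
  obtain ⟨k, F, hhol, hinv, hstab, hgrowth, hq⟩ := hCW W D
  exact forall_gamma1_cuspSymbol_mem_of_cDivisionWitness₁_of_UDW D (UDWOfCDT.unboundedDenominatorsWeightAlgInt_of_CDT_algInt hCDT k)
    hhol hinv hstab hgrowth hq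


end Summit.BirchSwinnertonDyer.BirchSwinnertonDyer.Theorems.ManinLocalTwoThree.CDivisionNeron

end
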